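import Literature.Probability.Percolation.AnchoredProfileExploration
import HarnessLib

/-!
# Cerf–Dembin 2020, proof of Theorem 1.2, II: volume growth under the isoperimetric hypothesis

Topic: `Literature/Probability/Percolation`. Second proof file of
`Literature.Probability.Percolation.CerfDembin2020_thm12` (Cerf–Dembin, ECP 25 (2020),
arXiv:1903.08065, Thm. 1.2). On the event `{inf_{k ≥ n₀} k φ̂_k(p_c) > c}` the paper proves by
induction (display (ire)) that the exploration clusters grow like `|𝒞_{(n-n₀)k}| ≥ α n^d`
(`α = 1/n₀^d`, `k ≥ 2^{d+1} d / c`), using the exploration inequality (iter) and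
`(n+1)^d ≤ n^d + 2^d n^{d-1}`. Here:

* `growth` — the printed induction, for an abstract nondecreasing `b : ℕ → ℕ` (`b l = |𝒞_l|`) with
  `b 0 ≥ 1` satisfying the isoperimetric step
  `b l ≤ n^d, n ≥ N ⇒ c · b l < 2d · n · (b (l+1) - b l)`: `(N + j)^d ≤ N^d · b (j k)` for all `j`
  (we take `k ≥ d² 2^d / c` and the cruder binomial estimate `(n+1)^d ≤ n^d + d 2^{d-1} n^{d-1}`,
  `pow_succ_le_add`; the constants are immaterial);
* `growth_bound` — the floor-free consequence `m^d ≤ (N k)^d · b m` for every `m`;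
* `boundary_lower_bound` — the deterministic heart of the proof of Thm. 1.2: if a configuration
  `ω` violates the conclusion of the theorem with constants `c`, `N` (every valid `H` with
  `|H| ≤ n^d`, `n ≥ N`, has `c |H| < n |∂°H|`), then for every `n ≥ N` the cluster of `0` inside
  `Λ(n)` meets the `2d` faces of `Λ(n)` in at least `γ n^{d-1}` vertices in total, `γ = γ(c,N,d) > 0`
  ("the intersection of the cluster that we have explored with the boundary of the box `[-n,n]^d` is
  of order `n^{d-1}`").

## References

* R. Cerf, B. Dembin, ECP 25 (2020), paper no. 19, arXiv:1903.08065, §2, proof of Theorem 1.2,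
  displays (iter), (ire).
-/

noncomputable section

namespace Literature.Probability.Percolation

open LatticeModels Finset
open scoped Classical

namespace CerfDembin

variable {d : ℕ}

/-! ## Arithmetic -/

/-- `(n+1)^{e+1} ≤ n^{e+1} + (e+1) 2^e n^e` for real `n ≥ 1` (a crude form of the binomial
estimate `(n+1)^d ≤ n^d + 2^d n^{d-1}` of the printed proof). [folklore] -/
theorem pow_succ_le_add (e : ℕ) {n : ℝ} (hn : 1 ≤ n) :
    (n + 1) ^ (e + 1) ≤ n ^ (e + 1) + (e + 1) * 2 ^ e * n ^ e := by
  induction e with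
  | zero => norm_num
  | succ e ih =>
    have hn0 : 0 ≤ n := by linarith
    have h1 : n ^ (e + 1) ≤ 2 ^ (e + 1) * n ^ (e + 1) :=
      le_mul_of_one_le_left (by positivity) (one_le_pow₀ (by norm_num))
    have h2 : ((e : ℝ) + 1) * 2 ^ e * n ^ e * (n + 1) ≤ ((e : ℝ) + 1) * 2 ^ e * n ^ e * (2 * n) :=
      mul_le_mul_of_nonneg_left (by linarith) (by positivity)
    calc (n + 1) ^ (e + 1 + 1) = (n + 1) ^ (e + 1) * (n + 1) := pow_succ _ _
      _ ≤ (n ^ (e + 1) + (e + 1) * 2 ^ e * n ^ e) * (n + 1) :=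
          mul_le_mul_of_nonneg_right ih (by linarith)
      _ = n ^ (e + 1 + 1) + n ^ (e + 1) + ((e : ℝ) + 1) * 2 ^ e * n ^ e * (n + 1) := by ring
      _ ≤ n ^ (e + 1 + 1) + 2 ^ (e + 1) * n ^ (e + 1) + ((e : ℝ) + 1) * 2 ^ e * n ^ e * (2 * n) := by
          linarith
      _ = n ^ (e + 1 + 1) + (↑(e + 1) + 1) * 2 ^ (e + 1) * n ^ (e + 1) := by push_cast; ring

/-- **The volume-growth induction** (Cerf–Dembin 2020, §2, display (ire) "`|𝒞_{(n-n₀)k}| ≥ α n^d`"):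
for a nondecreasing `b : ℕ → ℕ` with `b 0 ≥ 1` such that `c · b l < 2d · n · (b (l+1) - b l)`
whenever `N ≤ n` and `b l ≤ n^d` (the isoperimetric hypothesis combined with the exploration
inequality (iter)), one has `(N + j)^d ≤ N^d · b (j k)` for every `j`, provided `N ≥ 2` and
`k ≥ d² 2^d / c` (here `d = e + 1`). [cite: CerfDembin2020, §2 (proof of Thm. 1.2, display (ire))] -/
theorem growth {e N k : ℕ} {c : ℝ} (hN : 2 ≤ N) (hc : 0 < c)
    (hk : ((e : ℝ) + 1) ^ 2 * 2 ^ (e + 1) / c ≤ k)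
    {b : ℕ → ℕ} (hb0 : 1 ≤ b 0) (hmono : Monotone b)
    (H : ∀ l n : ℕ, N ≤ n → b l ≤ n ^ (e + 1) →
      c * b l < 2 * ((e : ℝ) + 1) * n * ((b (l + 1) : ℝ) - b l)) :
    ∀ j : ℕ, ((N : ℝ) + j) ^ (e + 1) ≤ (N : ℝ) ^ (e + 1) * b (j * k) := by
  have hN2 : (2 : ℝ) ≤ N := by exact_mod_cast hN
  intro j
  induction j with
  | zero =>
    simp only [Nat.cast_zero, add_zero, zero_mul]
    exact le_mul_of_one_le_right (by positivity) (by exact_mod_cast hb0)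
  | succ j ih =>
    set n : ℕ := N + j with hn
    have hncast : (n : ℝ) = N + j := by rw [hn]; push_cast; ring
    have hn1 : (1 : ℝ) ≤ n := by rw [hncast]; linarith [(Nat.cast_nonneg j : (0 : ℝ) ≤ j)]
    have hNn : N ≤ n := Nat.le_add_right N j
    have hcast : ((N : ℝ) + ↑(j + 1)) = n + 1 := by rw [hncast]; push_cast; ring
    rw [hcast]
    have ih' : (n : ℝ) ^ (e + 1) ≤ (N : ℝ) ^ (e + 1) * b (j * k) := by rw [hncast]; exact ih
    by_cases hcase : (n : ℝ) ^ (e + 1) ≤ b ((j + 1) * k)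
    · calc ((n : ℝ) + 1) ^ (e + 1) ≤ ((N : ℝ) * n) ^ (e + 1) := by
            apply pow_le_pow_left₀ (by linarith)
            nlinarith
        _ = (N : ℝ) ^ (e + 1) * (n : ℝ) ^ (e + 1) := mul_pow _ _ _
        _ ≤ (N : ℝ) ^ (e + 1) * b ((j + 1) * k) := by gcongr
    · push Not at hcase
      set δ : ℝ := c * (n : ℝ) ^ e / (2 * ((e : ℝ) + 1)) with hδ
      have hδ0 : 0 ≤ δ := by positivity
      have claim : ∀ i : ℕ, i ≤ k →
          (n : ℝ) ^ (e + 1) + i * δ ≤ (N : ℝ) ^ (e + 1) * b (j * k + i) := by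
        intro i
        induction i with
        | zero => intro _; simpa using ih'
        | succ i ihi =>
          intro hik
          have hi : i ≤ k := Nat.le_of_succ_le hik
          have h1 := ihi hi
          have hbl : b (j * k + i) ≤ n ^ (e + 1) := by
            have hle : b (j * k + i) ≤ b ((j + 1) * k) :=
              hmono (by rw [Nat.succ_mul]; omega)
            have : (b (j * k + i) : ℝ) < (n : ℝ) ^ (e + 1) :=
              lt_of_le_of_lt (by exact_mod_cast hle) hcase
            exact_mod_cast this.le
          have h2 := H (j * k + i) n hNn hbl
          have h3 : (n : ℝ) ^ (e + 1) ≤ (N : ℝ) ^ (e + 1) * b (j * k + i) :=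
            le_trans (le_add_of_nonneg_right (by positivity)) h1
          have hnpos : (0 : ℝ) < n := by linarith
          have h4 : δ ≤ (N : ℝ) ^ (e + 1) * ((b (j * k + i + 1) : ℝ) - b (j * k + i)) := by
            have key : c * (n : ℝ) ^ (e + 1) ≤
                2 * ((e : ℝ) + 1) * n *
                  ((N : ℝ) ^ (e + 1) * ((b (j * k + i + 1) : ℝ) - b (j * k + i))) := by
              calc c * (n : ℝ) ^ (e + 1) ≤ c * ((N : ℝ) ^ (e + 1) * b (j * k + i)) := by gcongr
                _ = (N : ℝ) ^ (e + 1) * (c * b (j * k + i)) := by ring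
                _ ≤ (N : ℝ) ^ (e + 1) *
                    (2 * ((e : ℝ) + 1) * n * ((b (j * k + i + 1) : ℝ) - b (j * k + i))) :=
                    mul_le_mul_of_nonneg_left h2.le (by positivity)
                _ = _ := by ring
            rw [hδ, div_le_iff₀ (by positivity)]
            rw [pow_succ] at key
            have key' : (c * (n : ℝ) ^ e) * n ≤
                ((N : ℝ) ^ (e + 1) * ((b (j * k + i + 1) : ℝ) - b (j * k + i)) *
                  (2 * ((e : ℝ) + 1))) * n := by linarith
            exact le_of_mul_le_mul_right key' hnpos
          calc (n : ℝ) ^ (e + 1) + ↑(i + 1) * δ = ((n : ℝ) ^ (e + 1) + i * δ) + δ := by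
                push_cast; ring
            _ ≤ (N : ℝ) ^ (e + 1) * b (j * k + i) +
                  (N : ℝ) ^ (e + 1) * ((b (j * k + i + 1) : ℝ) - b (j * k + i)) := add_le_add h1 h4
            _ = (N : ℝ) ^ (e + 1) * b (j * k + (i + 1)) := by rw [← add_assoc]; ring
      have hfinal := claim k le_rfl
      have hjk : j * k + k = (j + 1) * k := by ring
      rw [hjk] at hfinal
      have hkδ : ((e : ℝ) + 1) * 2 ^ e * (n : ℝ) ^ e ≤ k * δ := by
        have : ((e : ℝ) + 1) * 2 ^ e * (n : ℝ) ^ e =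
            (((e : ℝ) + 1) ^ 2 * 2 ^ (e + 1) / c) * δ := by
          rw [hδ]; field_simp; ring
        rw [this]
        exact mul_le_mul_of_nonneg_right hk hδ0
      calc ((n : ℝ) + 1) ^ (e + 1) ≤ (n : ℝ) ^ (e + 1) + ((e : ℝ) + 1) * 2 ^ e * (n : ℝ) ^ e :=
            pow_succ_le_add e hn1
        _ ≤ (n : ℝ) ^ (e + 1) + k * δ := by linarith
        _ ≤ _ := hfinal

/-- **Floor-free volume lower bound**: under the hypotheses of `growth` and `k ≥ 1`,
`m^d ≤ (N k)^d · b m` for every `m` (write `j = ⌊m/k⌋`; then `m < (j+1) k ≤ (N+j) k` and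
`b (j k) ≤ b m`). [cite: CerfDembin2020, §2 (proof of Thm. 1.2, "|𝒞_n| ≥ α ⌊n/k⌋^d")] -/
theorem growth_bound {e N k : ℕ} {c : ℝ} (hN : 2 ≤ N) (hc : 0 < c)
    (hk : ((e : ℝ) + 1) ^ 2 * 2 ^ (e + 1) / c ≤ k) (hk1 : 1 ≤ k)
    {b : ℕ → ℕ} (hb0 : 1 ≤ b 0) (hmono : Monotone b)
    (H : ∀ l n : ℕ, N ≤ n → b l ≤ n ^ (e + 1) →
      c * b l < 2 * ((e : ℝ) + 1) * n * ((b (l + 1) : ℝ) - b l))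
    (m : ℕ) : (m : ℝ) ^ (e + 1) ≤ ((N : ℝ) * k) ^ (e + 1) * b m := by
  set j := m / k with hj
  have hjk : j * k ≤ m := Nat.div_mul_le_self m k
  have hlt : m < j * k + k := Nat.lt_div_mul_add hk1
  have hgrow := growth hN hc hk hb0 hmono H j
  have hm : (m : ℝ) ≤ k * ((N : ℝ) + j) := by
    have h1 : (m : ℝ) < j * k + k := by exact_mod_cast hlt
    have hN1 : (1 : ℝ) ≤ N := by exact_mod_cast le_trans one_le_two hN
    have hk0 : (0 : ℝ) ≤ k := Nat.cast_nonneg k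
    nlinarith
  calc (m : ℝ) ^ (e + 1) ≤ ((k : ℝ) * ((N : ℝ) + j)) ^ (e + 1) :=
        pow_le_pow_left₀ (Nat.cast_nonneg m) hm _
    _ = (k : ℝ) ^ (e + 1) * ((N : ℝ) + j) ^ (e + 1) := mul_pow _ _ _
    _ ≤ (k : ℝ) ^ (e + 1) * ((N : ℝ) ^ (e + 1) * b (j * k)) := by gcongr
    _ ≤ (k : ℝ) ^ (e + 1) * ((N : ℝ) ^ (e + 1) * b m) := by gcongr; exact hmono hjk
    _ = ((N : ℝ) * k) ^ (e + 1) * b m := by ring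

/-! ## The deterministic heart of the proof of Theorem 1.2 -/

/-- **Many boundary connections under the isoperimetric hypothesis** (Cerf–Dembin 2020, §2, proof
of Thm. 1.2 up to display (eqabs)). Let `d = e + 1 ≥ 1`, `c > 0`, `N ≥ 2`. There is
`γ = γ(c, N, d) > 0` such that for every configuration `ω` in which every valid subgraph `H` of
`𝒞(0)` with `|H| ≤ n^d`, `n ≥ N`, satisfies `c |H| < n |∂°H|` (the negation of the conclusion of
Thm. 1.2 with these constants), and every `n ≥ N`, the cluster of `0` inside `Λ(n)` meets the faces
`{x_i = ± n}` of `Λ(n)` in at least `γ n^{d-1}` vertices in total: `γ n^d < n · Σ_{i,±} |𝒦_n ∩ face|`.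
Proof as printed: the exploration `𝒞_l` (valid, inequality (iter)) grows like `|𝒞_n| ≥ n^d/(Nk)^d`
(`growth_bound`); `𝒞_n ⊆ 𝒦_n`; `𝒦_n` is valid with `|𝒦_n| ≤ (3n)^d`, so the hypothesis at level
`3n` gives `c |𝒦_n| < 3n |∂°𝒦_n|`; and `|∂°𝒦_n| ≤ Σ_faces |𝒦_n ∩ face|`.
[cite: CerfDembin2020, §2 (proof of Thm. 1.2)] -/
theorem boundary_lower_bound (e : ℕ) {c : ℝ} (hc : 0 < c) {N : ℕ} (hN : 2 ≤ N) :
    ∃ γ : ℝ, 0 < γ ∧ ∀ ω : BondConfig (Site (e + 1)),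
      (∀ n : ℕ, N ≤ n → ∀ H : Finset (Site (e + 1)), IsValidSubgraph (e + 1) ω H →
          H.card ≤ n ^ (e + 1) → c * H.card < n * openEdgeBoundaryCard (e + 1) ω H) →
      ∀ n : ℕ, N ≤ n →
        γ * (n : ℝ) ^ (e + 1) < n * ∑ i : Fin (e + 1),
          ((#(((box (e + 1) n).filter fun x =>
              x ∈ openClusterIn (withinGraph (zdGraph (e + 1)) ↑(box (e + 1) n)) ω 0).filter
                fun x => x i = (n : ℤ)) : ℝ) +
            #(((box (e + 1) n).filter fun x =>
              x ∈ openClusterIn (withinGraph (zdGraph (e + 1)) ↑(box (e + 1) n)) ω 0).filter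
                fun x => x i = -(n : ℤ))) := by
  set k : ℕ := ⌈((e : ℝ) + 1) ^ 2 * 2 ^ (e + 1) / c⌉₊ + 1 with hkdef
  have hk : ((e : ℝ) + 1) ^ 2 * 2 ^ (e + 1) / c ≤ k := by
    rw [hkdef]; push_cast
    exact (Nat.le_ceil _).trans (le_add_of_nonneg_right zero_le_one)
  have hk1 : 1 ≤ k := by rw [hkdef]; omega
  have hNk : (0 : ℝ) < (N : ℝ) * k := by
    have : (0 : ℝ) < N := by exact_mod_cast lt_of_lt_of_le two_pos hN
    have : (0 : ℝ) < k := by exact_mod_cast hk1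
    positivity
  refine ⟨c / (3 * ((N : ℝ) * k) ^ (e + 1)), by positivity, ?_⟩
  intro ω hiso n hn
  -- the exploration process
  set C : ℕ → Finset (Site (e + 1)) := fun l => Nat.rec ({0} : Finset (Site (e + 1)))
    (fun _ S => S ∪ S.biUnion fun y =>
      ((zdGraph (e + 1)).neighborFinset y).filter fun x => s(y, x) ∈ ω) l with hC
  have h0 : C 0 = {0} := rfl
  have hsucc : ∀ l, C (l + 1) = C l ∪ (C l).biUnion fun y =>
      ((zdGraph (e + 1)).neighborFinset y).filter fun x => s(y, x) ∈ ω := fun l => rfl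
  -- its volume `b l = |𝒞_l|`
  have hb0 : 1 ≤ #(C 0) := by rw [h0, card_singleton]
  have hmono : Monotone fun l => #(C l) :=
    monotone_nat_of_le_succ fun l => card_le_card (explore_subset_succ hsucc l)
  have H : ∀ l m : ℕ, N ≤ m → #(C l) ≤ m ^ (e + 1) →
      c * #(C l) < 2 * ((e : ℝ) + 1) * m * ((#(C (l + 1)) : ℝ) - #(C l)) := by
    intro l m hm hbl
    have h1 := hiso m hm (C l) (explore_isValidSubgraph h0 hsucc l) hbl
    rw [openEdgeBoundaryCard_eq_card_filter] at h1
    have h2 := card_openBoundary_explore_le hsucc l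
    have hle : #(C l) ≤ #(C (l + 1)) := card_le_card (explore_subset_succ hsucc l)
    have h3 : (#((edgeBoundary (zdGraph (e + 1)) (C l)).filter (· ∈ ω)) : ℝ) ≤
        2 * ((e : ℝ) + 1) * ((#(C (l + 1)) : ℝ) - #(C l)) := by
      have : ((2 * (e + 1) * (#(C (l + 1)) - #(C l)) : ℕ) : ℝ) =
          2 * ((e : ℝ) + 1) * ((#(C (l + 1)) : ℝ) - #(C l)) := by
        push_cast [Nat.cast_sub hle]; ring
      rw [← this]; exact_mod_cast h2
    have hm0 : (0 : ℝ) ≤ m := Nat.cast_nonneg m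
    calc c * (#(C l) : ℝ) < m * #((edgeBoundary (zdGraph (e + 1)) (C l)).filter (· ∈ ω)) := h1
      _ ≤ m * (2 * ((e : ℝ) + 1) * ((#(C (l + 1)) : ℝ) - #(C l))) :=
          mul_le_mul_of_nonneg_left h3 hm0
      _ = _ := by ring
  -- volume lower bound for `𝒞_n`, hence for the cluster inside the box
  have hvol := growth_bound (b := fun l => #(C l)) hN hc hk hk1 hb0 hmono H n
  set Kf := (box (e + 1) n).filter fun x =>
    x ∈ openClusterIn (withinGraph (zdGraph (e + 1)) ↑(box (e + 1) n)) ω 0 with hKf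
  have hCK : #(C n) ≤ #Kf := card_le_card (explore_subset_boxCluster h0 hsucc n)
  have hn1 : 1 ≤ n := le_trans (by omega) hn
  -- the isoperimetric hypothesis for the cluster inside the box, at level `3n`
  have hKcard : #Kf ≤ (3 * n) ^ (e + 1) :=
    calc #Kf ≤ #(box (e + 1) n) := card_le_card (filter_subset _ _)
      _ = (2 * n + 1) ^ (e + 1) := card_box (e + 1) n
      _ ≤ (3 * n) ^ (e + 1) := Nat.pow_le_pow_left (by omega) _
  have hiso' := hiso (3 * n) (by omega) Kf (isValidSubgraph_boxCluster n ω) hKcard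
  rw [openEdgeBoundaryCard_eq_card_filter] at hiso'
  have hbdry := card_openBoundary_boxCluster_le n ω
  rw [← hKf] at hbdry
  have hbdry' : (#((edgeBoundary (zdGraph (e + 1)) Kf).filter (· ∈ ω)) : ℝ) ≤
      ∑ i : Fin (e + 1), ((#(Kf.filter fun x => x i = (n : ℤ)) : ℝ) +
        #(Kf.filter fun x => x i = -(n : ℤ))) := by
    exact_mod_cast hbdry
  have hn0 : (0 : ℝ) < n := by exact_mod_cast hn1
  -- assemble
  have hvol' : (n : ℝ) ^ (e + 1) ≤ ((N : ℝ) * k) ^ (e + 1) * #Kf :=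
    hvol.trans (by gcongr)
  have step : c / (3 * ((N : ℝ) * k) ^ (e + 1)) * (n : ℝ) ^ (e + 1) ≤ c * #Kf / 3 := by
    rw [div_mul_eq_mul_div, div_le_div_iff₀ (by positivity) (by norm_num)]
    nlinarith [hvol', hc]
  calc c / (3 * ((N : ℝ) * k) ^ (e + 1)) * (n : ℝ) ^ (e + 1) ≤ c * #Kf / 3 := step
    _ < (3 * n : ℕ) * #((edgeBoundary (zdGraph (e + 1)) Kf).filter (· ∈ ω)) / 3 := by gcongr
    _ = n * #((edgeBoundary (zdGraph (e + 1)) Kf).filter (· ∈ ω)) := by push_cast; ring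
    _ ≤ _ := mul_le_mul_of_nonneg_left hbdry' hn0.le

end CerfDembin

end Literature.Probability.Percolation
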